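import Literature.IUT.HodgeArakelov.EtaleThetaDataOfSettingInversion

/-!
# [IUTchII] Prop 2.2 (ii) at the MODEL: the inversion is an INVOLUTION up to an inner automorphism (laws for the (R2) consumer)

abc-iut cell (WAVE-5 seat abc-iut-w5-d072; cone of [IUTchIII] Cor. 3.12; DAG node **IUTchII:Prop2.2(ii)**; plan/GAP-LEDGER.md
row G-w4d010-2, disposition D-G-w4d010-2f; L6-lead §F v1.18a (a): the hroot INSTANCE (abc-iut-w4-d014 / abc-iut-L2-t8 p416087
`hroot_of_coeffChange_root`) consumes, next to the pair `(inversionAlpha C ι hι, c.thetaIso)` of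
`EtaleThetaDataOfSettingInversion.lean` (p416287), the law (i′) «`α ∘ α` is conjugation by an element `e`»). S. Mochizuki,
*Inter-universal Teichmüller theory II*, kurims manuscript (Dec. 2020), Rmk. 1.4.1 (ii) p. 28 («the unique ORDER TWO
`Δ^tp`-outer automorphism», the POINTED inversion) and Prop. 2.2 (ii) p. 66 (claim key `Mochizuki2012`, DISPUTED, D-0012);
[EtTh] Def. 1.7 p. 27 («`Gal(Ẍ/C) ≅ (ℤ/2ℤ)³`»: every square of `Π^tp_C` lies in `Π^tp_Ẍ ⊆ Π^tp_X` — abc-iut-L2-t1's field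
`MuTwoSetting.sq_mem_GtpXdd`) [cite: MochizukiEtTh2009, Def 1.7 p.27].

PROOF-ONLY companion (no definitions, no named facts):
* `inversionAlpha_inversionAlpha_of_sq` — GENERIC: if `ι ∘ ι = conj(e)` on `Π^tp_X` for some `e ∈ Π^tp_X̲̲`, then
  `α ∘ α = conj(e)` on `Π := Π^tp_X̲̲` for `α := inversionAlpha C ι hι` (the consumer's binder `hαα`);
* `exists_inclX_eq_epsPM_sq` / `epsPMConj_epsPMConj` — at [EtTh] Def. 1.7's `MuTwoSetting`: `ε_±² ∈ Π^tp_X` (indeed in `Π^tp_Ẍ`)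
  and `(ε_±-conjugation)² = conj(ε_±²)` on `Π^tp_X` — PROVED from `sq_mem_GtpXdd`; `epsPMInversion_epsPMInversion` likewise;
* `inversionAlpha_epsPM_sq` — hence `hαα` at `ι := epsPMInversion M hind` GIVEN that the square `ε_±²` lies in `Π^tp_X̲̲`
  (hypothesis `hsq` — automatic for a POINTED inversion, i.e. `ε_±` chosen of order `2` in `Π^tp_C`, Rmk. 1.4.1 (ii); not
  forced by the interface, whose `epsPM` is an arbitrary representative).
[claim: Mochizuki2012, status: disputed] Nothing here takes a side on [IUTchIII] Cor. 3.12; typed ≠ proved.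
-/

namespace Literature.IUT.HodgeArakelov

open Literature.AnabelianGeometry.EtaleTheta (ThetaSetting MuTwoSetting)
open EtaleThetaDataOfSetting

noncomputable section

namespace EtaleThetaDataOfSetting

variable {p : ℕ} [Fact p.Prime]

/-! ## Generic: `ι² = conj(e)` on `Π^tp_X` with `e ∈ Π^tp_X̲̲` gives `α² = conj(e)` on `Π^tp_X̲̲` -/

/-- **`α ∘ α = conj(e)`** for `α := ι|Π^tp_X̲̲`, when `ι ∘ ι` is conjugation by `e ∈ Π^tp_X̲̲` on `Π^tp_X` ([IUTchII] Rmk. 1.4.1 (ii):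
the pointed inversion has ORDER TWO as an outer automorphism) — the binder `hαα` of the hroot instance.
[claim: Mochizuki2012, status: disputed] (IUTchII §1 Rmk 1.4.1 (ii), kurims p.28) -/
theorem inversionAlpha_inversionAlpha_of_sq {D : Literature.AnabelianGeometry.EtaleTheta.ThetaSetting p}
    {E : D.EtaleThetaData} {l : ℕ} (C : E.DoubleUnderline l) (ι : D.PiTemp ≃ₜ* D.PiTemp)
    (hι : C.Huu.map ι.toMulEquiv.toMonoidHom = C.Huu) (e : Pi C)
    (hsq : ∀ x : D.PiTemp, ι (ι x) = (e : D.PiTemp) * x * (e : D.PiTemp)⁻¹) (g : Pi C) :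
    inversionAlpha C ι hι (inversionAlpha C ι hι g) = e * g * e⁻¹ := by
  apply Subtype.ext
  rw [coe_inversionAlpha, coe_inversionAlpha, hsq]
  rfl

/-! ## At [EtTh] Def. 1.7's `MuTwoSetting`: `(ε_±-conjugation)² = conj(ε_±²)`, `ε_±² ∈ Π^tp_Ẍ ⊆ Π^tp_X` -/

/-- **`ε_±² ∈ Π^tp_X`** (indeed in `Π^tp_Ẍ`: «`Gal(Ẍ/C) ≅ (ℤ/2ℤ)³`», [EtTh] Def. 1.7 p. 27 — abc-iut-L2-t1's `sq_mem_GtpXdd`): there is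
a (unique) `e ∈ Π^tp_X` with `inclX e = ε_± · ε_±`, and it lies in `Π^tp_Ẍ`. [cite: MochizukiEtTh2009, Def 1.7 p.27] -/
theorem exists_inclX_eq_epsPM_sq (M : Literature.AnabelianGeometry.EtaleTheta.MuTwoSetting p) :
    ∃ e : M.PiTemp, e ∈ M.GtpXdd ∧ M.inclX e = M.epsPM * M.epsPM := by
  obtain ⟨e, he, hee⟩ := M.sq_mem_GtpXdd M.epsPM
  exact ⟨e, he, hee⟩

/-- **`(ε_±-conjugation) ∘ (ε_±-conjugation) = conj(e)` on `Π^tp_X`**, for the element `e ∈ Π^tp_X` with `inclX e = ε_±²`.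
[cite: MochizukiEtTh2009, Def 1.7 p.27] -/
theorem epsPMConj_epsPMConj (M : Literature.AnabelianGeometry.EtaleTheta.MuTwoSetting p) (e : M.PiTemp)
    (he : M.inclX e = M.epsPM * M.epsPM) (x : M.PiTemp) :
    epsPMConj M (epsPMConj M x) = e * x * e⁻¹ := by
  apply M.injective_inclX
  rw [inclX_epsPMConj, inclX_epsPMConj, map_mul, map_mul, map_inv, he]
  group

/-- `ι ∘ ι = conj(e)` on `Π^tp_X` for `ι := epsPMInversion M hind`. [cite: MochizukiEtTh2009, Def 1.7 p.27] -/
theorem epsPMInversion_epsPMInversion (M : Literature.AnabelianGeometry.EtaleTheta.MuTwoSetting p)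
    (hind : Topology.IsInducing M.inclX) (e : M.PiTemp) (he : M.inclX e = M.epsPM * M.epsPM) (x : M.PiTemp) :
    epsPMInversion M hind (epsPMInversion M hind x) = e * x * e⁻¹ :=
  epsPMConj_epsPMConj M e he x

/-- **`hαα` at Def. 1.7's setting**: for `ι := (ε_±-conjugation)|Π^tp_X` and `α := ι|Π^tp_X̲̲`, `α ∘ α = conj(e)` on `Π^tp_X̲̲` for the
element `e ∈ Π^tp_X̲̲` with `inclX e = ε_±²` — GIVEN that this square lies in `Π^tp_X̲̲` (`hsq`: automatic for a pointed inversion,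
`ε_±` of order `2` in `Π^tp_C`, [IUTchII] Rmk. 1.4.1 (ii); an input otherwise). [claim: Mochizuki2012, status: disputed]
(IUTchII §1 Rmk 1.4.1 (ii), kurims p.28) -/
theorem inversionAlpha_epsPM_sq (M : Literature.AnabelianGeometry.EtaleTheta.MuTwoSetting p)
    (hind : Topology.IsInducing M.inclX) {E : M.toThetaSetting.EtaleThetaData} {l : ℕ} (C : E.DoubleUnderline l)
    (hι : C.Huu.map (epsPMInversion M hind).toMulEquiv.toMonoidHom = C.Huu) (e : Pi C)
    (he : M.inclX (e : M.PiTemp) = M.epsPM * M.epsPM) (g : Pi C) :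
    inversionAlpha C (epsPMInversion M hind) hι (inversionAlpha C (epsPMInversion M hind) hι g) = e * g * e⁻¹ :=
  inversionAlpha_inversionAlpha_of_sq C (epsPMInversion M hind) hι e
    (fun x => epsPMInversion_epsPMInversion M hind (e : M.PiTemp) he x) g

end EtaleThetaDataOfSetting

end

end Literature.IUT.HodgeArakelov
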